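import Summits.BirchSwinnertonDyer.BirchSwinnertonDyer.Theorems.ResidualThetaTransportAtTwoSignedMuVanishingAtTwoPlusCuspSpanGenerationTwoPrimesTools
import HarnessLib

/-!
# Node (G′)_N = `CuspSpanEvenAtTwo N` (item 27436; cruxes Kμ⁺ 20689 / Kan⁺ 20688 / 21437): TOOLS for the rows-`{1,2,4}` generation
# theorem at odd levels with at most three prime factors — transfer at determinant `m`, the `|d| ≤ 1` elements at any level, and the
# arithmetic «five bad residues around two coprime bad parents force four distinct prime factors»

Cell `bsd-wall`, width seat `bsd-wall-rtt-p4-w2` g7 (crux Kμ⁺ stmt-BirchSwinnertonDyer-20689, line `birth`, stub `stub_flatMuZeroAtTwo` ⟸ node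
27436). THEOREMS ONLY (no `def`, no named fact, no `sorry`); helper `--supports` the crux; BSD is not proved by this. Part 1 of 2: consumed
by `…CuspSpanRowsThreePrimes` (the generation theorem `Rows124.chi_eq_zero_of_rows124` and the node corollary
`Rows124.cuspSpanEvenAtTwo_of_card_primeFactors_le_three`). Contents (namespace `…SignedMuAtTwo.Rows124`):

* `chi_eq_of_secondCol_of_natAbs` — **transfer at determinant `m`**: two elements of `Γ₀(N)` whose second columns `(b,d)`, `(b′,d′)`
  satisfy `|d b′ − b d′| = m` have the same value under every additive `χ` killing the row `|b| = m` (`γ⁻¹γ′` has upper-right entry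
  `d b′ − b d′`; the lead's `TwoPrimes.chi_eq_of_secondCol` is the case `m ≤ 1`);
* `chi_eq_zero_of_natAbs_d_le_one'` — elements with `|d| ≤ 1` are killed at ANY level (`d = 0` forces `|b| = 1`);
* `exists_prime_dvd_of_not_isCoprime`, `four_le_card_of_mem` — bookkeeping;
* `four_le_card_primeFactors` — for `N` odd and `d₁, d₂` coprime: if none of `d₁, d₂, d₂ − d₁, d₂ − 3d₁` and not both of `d₂ ∓ 2d₁` are
  prime to `N`, then `N` has at least four distinct prime factors (`p ∣ d₁`, `q ∣ d₂`, `r ∣ d₂ − d₁` pairwise distinct; `s ∣ d₂ − 3d₁` is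
  `∉ {p, r}` and `s = q` forces `q = 3`; then `t ∣ d₂ ∓ 2d₁` is a fourth).

References: R. S. Kulkarni, Amer. J. Math. 113 (1991) 1053–1133, §2 (Farey symbols) [Kulkarni1991]; H. Rademacher, Abh. Math. Sem.
Hamburg 7 (1929) §1 [Rademacher1929]; A. W. Knapp, *Elliptic curves* (1992) Prop. 11.22 [Knapp1993].
-/

set_option autoImplicit false
set_option linter.dupNamespace false

open scoped MatrixGroups

open CongruenceSubgroup

namespace Summit.BirchSwinnertonDyer.BirchSwinnertonDyer.Theorems.SignedMuAtTwo

namespace Rows124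

open TwoPrimes

variable {N : ℕ} {χ : Gamma0 N → ZMod 2}

/-! ## §1. Transfer at determinant `m`; the `|d| ≤ 1` elements at any level -/

/-- **Transfer at determinant `m`.** If the second columns `(b, d)`, `(b′, d′)` of `γ, γ′ ∈ Γ₀(N)` satisfy `|d b′ − b d′| = m` and `χ` is
additive and kills every element whose upper-right entry has absolute value `m`, then `χ γ = χ γ′` (`γ⁻¹γ′` has upper-right entry
`d b′ − b d′`). [cite: Kulkarni1991, §2] -/
theorem chi_eq_of_secondCol_of_natAbs (hadd : ∀ γ δ : Gamma0 N, χ (γ * δ) = χ γ + χ δ) {m : ℕ}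
    (hBm : ∀ β : Gamma0 N, ((β : SL(2, ℤ)) 0 1).natAbs = m → χ β = 0) (γ γ' : Gamma0 N)
    (hdet : ((γ : SL(2, ℤ)) 1 1 * (γ' : SL(2, ℤ)) 0 1 - (γ : SL(2, ℤ)) 0 1 * (γ' : SL(2, ℤ)) 1 1).natAbs = m) :
    χ γ = χ γ' := by
  obtain ⟨e01, -, -⟩ := inv_mul_entries γ γ'
  have hβ : χ (γ⁻¹ * γ') = 0 := hBm _ (by rw [e01]; exact hdet)
  have h := hadd γ (γ⁻¹ * γ')
  rw [mul_inv_cancel_left, hβ, add_zero] at h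
  exact h.symm

/-- **`|d| ≤ 1` elements are killed, at any level** (also `N = 1`): for `d = 0` the determinant forces `|b| = 1`, and for `d = ±1` the
element `T^{−bd}·γ` has `b = 0`, hence is `±(1 0; * 1)` (trace `±2`). [folklore] -/
theorem chi_eq_zero_of_natAbs_d_le_one' (hadd : ∀ γ δ : Gamma0 N, χ (γ * δ) = χ γ + χ δ)
    (hsmall : ∀ γ : Gamma0 N, ((γ : SL(2, ℤ)) 0 0 + (γ : SL(2, ℤ)) 1 1).natAbs ≤ 2 → χ γ = 0)
    (hB1 : ∀ β : Gamma0 N, ((β : SL(2, ℤ)) 0 1).natAbs = 1 → χ β = 0) (γ : Gamma0 N)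
    (hd : ((γ : SL(2, ℤ)) 1 1).natAbs ≤ 1) : χ γ = 0 := by
  set a := (γ : SL(2, ℤ)) 0 0 with hadef
  set b := (γ : SL(2, ℤ)) 0 1 with hbdef
  set c := (γ : SL(2, ℤ)) 1 0 with hcdef
  set d := (γ : SL(2, ℤ)) 1 1 with hddef
  have hdet : a * d - b * c = 1 := by
    have := Matrix.SpecialLinearGroup.det_coe (γ : SL(2, ℤ))
    rwa [Matrix.det_fin_two] at this
  rcases Nat.lt_or_ge d.natAbs 1 with h0 | h1
  · -- `d = 0`: `-(b c) = 1`, so `|b| = 1`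
    have hd0 : d = 0 := Int.natAbs_eq_zero.mp (by omega)
    rw [hd0, mul_zero, zero_sub] at hdet
    refine hB1 γ ?_
    have h := congrArg Int.natAbs hdet
    rw [Int.natAbs_neg, Int.natAbs_mul] at h
    exact Nat.eq_one_of_mul_eq_one_right (by simpa using h)
  · -- `d = ±1`: multiply on the left by `T^{-b d}`
    have hd1 : d * d = 1 := by
      have h1 : d.natAbs = 1 := le_antisymm hd h1
      rcases Int.natAbs_eq d with h | h <;> rw [h1] at h <;> rw [h] <;> norm_num
    obtain ⟨T, hT00, hT01, hT10, hT11⟩ :=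
      ThetaLayerLambdaCongruenceAtTwo.exists_gamma0_entries (N := N) 1 (-(b * d)) 0 1 (by ring) (dvd_zero _)
    have hT : χ T = 0 := hsmall T (by rw [hT00, hT11]; rfl)
    have e01 : ((T * γ : Gamma0 N) : SL(2, ℤ)) 0 1 = 0 := by
      rw [gamma0_mul_apply_zero_one, hT00, hT01, ← hbdef, ← hddef]; linear_combination (-b) * hd1
    have e11 : ((T * γ : Gamma0 N) : SL(2, ℤ)) 1 1 = d := by
      rw [gamma0_mul_apply_one_one', hT10, hT11, ← hbdef, ← hddef]; ring
    have hdet' := Matrix.SpecialLinearGroup.det_coe ((T * γ : Gamma0 N) : SL(2, ℤ))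
    rw [Matrix.det_fin_two, e01, e11, zero_mul, sub_zero] at hdet'
    have hTγ : χ (T * γ) = 0 := by
      refine hsmall _ ?_
      rw [e11]
      rcases Int.eq_one_or_neg_one_of_mul_eq_one' hdet' with ⟨h1, h2⟩ | ⟨h1, h2⟩ <;> rw [h1, h2] <;> rfl
    exact chi_eq_zero_of_mul_left hadd hTγ hT

/-! ## §2. Arithmetic: five bad residues around a pair of coprime bad parents force four distinct prime factors -/

/-- A non-coprime pair `(a, N)` has a common prime factor. [folklore] -/
theorem exists_prime_dvd_of_not_isCoprime {a : ℤ} (h : ¬ IsCoprime a (N : ℤ)) :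
    ∃ p : ℕ, p.Prime ∧ (p : ℤ) ∣ a ∧ p ∣ N := by
  rw [Int.isCoprime_iff_gcd_eq_one] at h
  obtain ⟨p, hp, hpg⟩ := Nat.exists_prime_and_dvd h
  refine ⟨p, hp, ?_, ?_⟩
  · exact (Int.natCast_dvd_natCast.mpr hpg).trans (Int.gcd_dvd_left _ _)
  · exact Int.natCast_dvd_natCast.mp ((Int.natCast_dvd_natCast.mpr hpg).trans (Int.gcd_dvd_right _ _))

/-- Four pairwise distinct members give `4 ≤ card`. [folklore] -/
theorem four_le_card_of_mem {s : Finset ℕ} {p q r t : ℕ} (hp : p ∈ s) (hq : q ∈ s) (hr : r ∈ s) (ht : t ∈ s)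
    (hpq : p ≠ q) (hpr : p ≠ r) (hpt : p ≠ t) (hqr : q ≠ r) (hqt : q ≠ t) (hrt : r ≠ t) : 4 ≤ s.card := by
  have hsub : ({p, q, r, t} : Finset ℕ) ⊆ s := by
    intro x hx
    simp only [Finset.mem_insert, Finset.mem_singleton] at hx
    rcases hx with rfl | rfl | rfl | rfl <;> assumption
  have hcard : ({p, q, r, t} : Finset ℕ).card = 4 := by
    rw [Finset.card_insert_of_notMem (by simp [hpq, hpr, hpt]), Finset.card_insert_of_notMem (by simp [hqr, hqt]),
      Finset.card_insert_of_notMem (by simp [hrt]), Finset.card_singleton]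
  exact hcard ▸ Finset.card_le_card hsub

/-- **Four distinct prime factors.** Let `N` be odd and `d₁, d₂` coprime integers such that none of `d₁`, `d₂`, `d₂ − d₁`, `d₂ − 3d₁` is
prime to `N`, and one of `d₂ − 2d₁`, `d₂ + 2d₁` is not prime to `N`. Then `N` has at least four distinct prime factors: with primes
`p ∣ d₁`, `q ∣ d₂`, `r ∣ d₂ − d₁`, `s ∣ d₂ − 3d₁`, `t ∣ d₂ ∓ 2d₁` of `N` (all odd), `p, q, r` are pairwise distinct, `s ∉ {p, r}`, `s = q`
forces `q = 3`, and then `t ∉ {p, q, r}`. [folklore] -/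
theorem four_le_card_primeFactors (hN : Odd N) {d₁ d₂ : ℤ} (hcop : IsCoprime d₁ d₂)
    (h1 : ¬ IsCoprime d₁ (N : ℤ)) (h2 : ¬ IsCoprime d₂ (N : ℤ)) (h3 : ¬ IsCoprime (d₂ - d₁) (N : ℤ))
    (h4 : ¬ IsCoprime (d₂ - 3 * d₁) (N : ℤ))
    (h5 : ¬ IsCoprime (d₂ - 2 * d₁) (N : ℤ) ∨ ¬ IsCoprime (d₂ + 2 * d₁) (N : ℤ)) : 4 ≤ N.primeFactors.card := by
  have hN0 : N ≠ 0 := by rintro rfl; exact (Nat.not_odd_iff_even.mpr Even.zero) hN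
  -- a prime factor of `N` is odd, i.e. (as an integer prime) does not divide `2`
  have hodd : ∀ p : ℕ, p.Prime → p ∣ N → ¬ (p : ℤ) ∣ 2 := by
    intro p hp hpN h2
    have h2' : p ∣ 2 := by exact_mod_cast h2
    have hp2 : p = 2 := (Nat.prime_dvd_prime_iff_eq hp Nat.prime_two).mp h2'
    subst hp2
    exact (Nat.not_even_iff_odd.mpr hN) (even_iff_two_dvd.mpr hpN)
  have mem : ∀ p : ℕ, p.Prime → p ∣ N → p ∈ N.primeFactors := fun p hp hpN ↦ Nat.mem_primeFactors.mpr ⟨hp, hpN, hN0⟩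
  -- no prime divides both `d₁` and `d₂`
  have key : ∀ ℓ : ℕ, ℓ.Prime → (ℓ : ℤ) ∣ d₁ → (ℓ : ℤ) ∣ d₂ → False :=
    fun ℓ hℓ hℓ1 hℓ2 ↦ (Nat.prime_iff_prime_int.mp hℓ).not_unit (hcop.isUnit_of_dvd' hℓ1 hℓ2)
  obtain ⟨p, hp, hpd, hpN⟩ := exists_prime_dvd_of_not_isCoprime h1
  obtain ⟨q, hq, hqd, hqN⟩ := exists_prime_dvd_of_not_isCoprime h2
  obtain ⟨r, hr, hrd, hrN⟩ := exists_prime_dvd_of_not_isCoprime h3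
  obtain ⟨s, hs, hsd, hsN⟩ := exists_prime_dvd_of_not_isCoprime h4
  have hq' : Prime (q : ℤ) := Nat.prime_iff_prime_int.mp hq
  have hr' : Prime (r : ℤ) := Nat.prime_iff_prime_int.mp hr
  -- `p, q, r` pairwise distinct
  have hpq : p ≠ q := by rintro rfl; exact key p hp hpd hqd
  have hpr : p ≠ r := by
    rintro rfl
    exact key p hp hpd (by have := dvd_add hrd hpd; rwa [sub_add_cancel] at this)
  have hqr : q ≠ r := by
    rintro rfl
    exact key q hq (by have := dvd_sub hqd hrd; rwa [sub_sub_cancel] at this) hqd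
  -- `s ≠ p`, `s ≠ r`
  have hsp : s ≠ p := by
    rintro rfl
    exact key s hs hpd (by have := dvd_add hsd (hpd.mul_left 3); rwa [sub_add_cancel] at this)
  have hsr : s ≠ r := by
    rintro rfl
    -- `s ∣ (d₂ - d₁) - (d₂ - 3 d₁) = 2 d₁`, `s` odd, so `s ∣ d₁`, then `s ∣ d₂`
    have h2d : (s : ℤ) ∣ 2 * d₁ := by have := dvd_sub hrd hsd; rwa [show d₂ - d₁ - (d₂ - 3 * d₁) = 2 * d₁ by ring] at this
    have hsd1 : (s : ℤ) ∣ d₁ := ((Nat.prime_iff_prime_int.mp hs).dvd_or_dvd h2d).resolve_left (hodd s hs hsN)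
    exact key s hs hsd1 (by have := dvd_add hrd hsd1; rwa [sub_add_cancel] at this)
  by_cases hsq : s = q
  · -- then `q = 3`-type situation: the fifth residue gives the fourth prime
    subst hsq
    -- `s ∣ 3 d₁` and `s ∤ d₁`
    have hs3 : (s : ℤ) ∣ 3 * d₁ := by
      have := dvd_sub hqd hsd; rwa [show d₂ - (d₂ - 3 * d₁) = 3 * d₁ by ring] at this
    have hsnd1 : ¬ (s : ℤ) ∣ d₁ := fun h ↦ key s hs h hqd
    have hs3' : (s : ℤ) ∣ 3 := (hq'.dvd_or_dvd hs3).resolve_right hsnd1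
    rcases h5 with h5 | h5
    · obtain ⟨t, ht, htd, htN⟩ := exists_prime_dvd_of_not_isCoprime h5
      have htp : t ≠ p := by
        rintro rfl
        exact key t ht hpd (by have := dvd_add htd (hpd.mul_left 2); rwa [sub_add_cancel] at this)
      have htq : t ≠ s := by
        rintro rfl
        -- `s ∣ d₂ - (d₂ - 2 d₁) = 2 d₁`
        have h2d : (t : ℤ) ∣ 2 * d₁ := by
          have := dvd_sub hqd htd; rwa [show d₂ - (d₂ - 2 * d₁) = 2 * d₁ by ring] at this
        exact hsnd1 (((Nat.prime_iff_prime_int.mp ht).dvd_or_dvd h2d).resolve_left (hodd t ht htN))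
      have htr : t ≠ r := by
        rintro rfl
        -- `r ∣ (d₂ - d₁) - (d₂ - 2 d₁) = d₁`
        have hd : (t : ℤ) ∣ d₁ := by
          have := dvd_sub hrd htd; rwa [show d₂ - d₁ - (d₂ - 2 * d₁) = d₁ by ring] at this
        exact key t ht hd (by have := dvd_add hrd hd; rwa [sub_add_cancel] at this)
      exact four_le_card_of_mem (mem p hp hpN) (mem s hs hsN) (mem r hr hrN) (mem t ht htN) hpq hpr htp.symm hqr htq.symm
        htr.symm
    · obtain ⟨t, ht, htd, htN⟩ := exists_prime_dvd_of_not_isCoprime h5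
      have ht' : Prime (t : ℤ) := Nat.prime_iff_prime_int.mp ht
      have htp : t ≠ p := by
        rintro rfl
        exact key t ht hpd (by have := dvd_sub htd (hpd.mul_left 2); rwa [add_sub_cancel_right] at this)
      have htq : t ≠ s := by
        rintro rfl
        have h2d : (t : ℤ) ∣ 2 * d₁ := by
          have := dvd_sub htd hqd; rwa [show d₂ + 2 * d₁ - d₂ = 2 * d₁ by ring] at this
        exact hsnd1 ((ht'.dvd_or_dvd h2d).resolve_left (hodd t ht htN))
      have htr : t ≠ r := by
        rintro rfl
        -- `r ∣ (d₂ + 2 d₁) - (d₂ - d₁) = 3 d₁`; `r ∤ d₁` (else `r ∣ d₂`), so `r ∣ 3`, and `s ∣ 3`: `r = s`, contradiction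
        have h3d : (t : ℤ) ∣ 3 * d₁ := by
          have := dvd_sub htd hrd; rwa [show d₂ + 2 * d₁ - (d₂ - d₁) = 3 * d₁ by ring] at this
        have hrnd1 : ¬ (t : ℤ) ∣ d₁ := fun h ↦ key t ht h (by have := dvd_add hrd h; rwa [sub_add_cancel] at this)
        have hr3 : (t : ℤ) ∣ 3 := (ht'.dvd_or_dvd h3d).resolve_right hrnd1
        have hr3' : t ∣ 3 := by exact_mod_cast hr3
        have hs3'' : s ∣ 3 := by exact_mod_cast hs3'
        have e1 : t = 3 := (Nat.prime_dvd_prime_iff_eq ht Nat.prime_three).mp hr3'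
        have e2 : s = 3 := (Nat.prime_dvd_prime_iff_eq hs Nat.prime_three).mp hs3''
        exact hqr (e2.trans e1.symm)
      exact four_le_card_of_mem (mem p hp hpN) (mem s hs hsN) (mem r hr hrN) (mem t ht htN) hpq hpr htp.symm hqr htq.symm
        htr.symm
  · exact four_le_card_of_mem (mem p hp hpN) (mem q hq hqN) (mem r hr hrN) (mem s hs hsN) hpq hpr hsp.symm hqr
      (fun h ↦ hsq h.symm) hsr.symm

end Rows124

end Summit.BirchSwinnertonDyer.BirchSwinnertonDyer.Theorems.SignedMuAtTwo
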